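import Literature.GroupTheory.CombinatorialGroupTheory.PuncturedSurfaceGroupUnrQuotientCoprod
import HarnessLib

/-!
# The unramified quotient of the IRREDUCIBLE one-nodal degeneration: `Γ_{g+1,r}/⟨⟨b_0, c_j⟩⟩ ≅ Γ_{g,0} ∗ ℤ`

Topic `Literature/GroupTheory/CombinatorialGroupTheory`; theorems only (a Tietze computation).  [CombGC]
Def. 1.1 (ii) p. 7 (the unramified quotient `Π^unr_G`) [cite: MochizukiCombGC2007, Def 1.1(ii) p.7] at the
IRREDUCIBLE ONE-NODAL data of abc-iut-f-164 gen 2 (`PSCIrreducibleNodalShape.lean` /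
`PSCIrreducibleNodalOrigin.lean`: an irreducible pointed stable curve with ONE node — dual semi-graph a single
vertex with a LOOP —, `Γ_{g+1,r}` the smoothing, node loop the non-separating simple closed curve `b_0`,
stable letter `a_0`).  Killing every cusp generator `c_j` and the node loop `b_0` kills the commutator
`[a_0, b_0]` and then, by the relator, `∏_{i≥1}[a_i,b_i]`; what is left is the free product of the CLOSED
surface group on the handles `i ≥ 1` with the free cyclic group on the stable letter `a_0` — the
`π₁` of the compact irreducible nodal curve, whose dual graph has first Betti number `1`.

* `exists_mulEquiv_irrNodalUnrQuotient_coprod` — an isomorphism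
  `Γ_{g+1,r} ⧸ ⟨⟨{b_0} ∪ {c_j}⟩⟩ ≃* Γ_{g,0} ∗ ℤ` (`Monoid.Coprod`, `ℤ` as `Multiplicative ℤ`) with
  `[a_{j+1}] ↦ inl a_j`, `[b_{j+1}] ↦ inl b_j`, `[a_0] ↦ inr 1`.

Step (i) of the `Π^unr`-separating-covering programme (door D1 of abc-iut-f-166 / abc-iut-w5-d047) at the
stratum `Δ_irr`; elementary; nothing here concerns [IUTchIII].
-/

namespace Literature.GroupTheory.CombinatorialGroupTheory

namespace PuncturedSurfaceGroup

open Monoid (Coprod)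
open Multiplicative (ofAdd toAdd)

/-- **`Γ_{g+1,r} ⧸ ⟨⟨b_0, c_0, …, c_{r−1}⟩⟩ ≅ Γ_{g,0} ∗ ℤ`** for the node loop `b_0` of the irreducible one-nodal
degeneration: the handles `i ≥ 1` go to the closed surface group, the stable letter `a_0` to the free
cyclic factor. [cite: MochizukiCombGC2007, Def 1.1(ii) p.7] -/
theorem exists_mulEquiv_irrNodalUnrQuotient_coprod (g r : ℕ) :
    ∃ (_hK : (Subgroup.normalClosure ({b (r := r) (0 : Fin (g + 1))} ∪
        Set.range (c : Fin r → PuncturedSurfaceGroup (g + 1) r))).Normal)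
      (e : PuncturedSurfaceGroup (g + 1) r ⧸
          Subgroup.normalClosure ({b (r := r) (0 : Fin (g + 1))} ∪
            Set.range (c : Fin r → PuncturedSurfaceGroup (g + 1) r)) ≃*
        Coprod (PuncturedSurfaceGroup g 0) (Multiplicative ℤ)),
      (∀ (j : Fin g) (bit : Bool),
        e (QuotientGroup.mk (PresentedGroup.of (Sum.inl (Fin.succ j, bit)))) =
          Coprod.inl (PresentedGroup.of (Sum.inl (j, bit)))) ∧
      e (QuotientGroup.mk (a (r := r) (0 : Fin (g + 1)))) = Coprod.inr (ofAdd (1 : ℤ)) := by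
  classical
  set K : Subgroup (PuncturedSurfaceGroup (g + 1) r) :=
    Subgroup.normalClosure ({b (r := r) (0 : Fin (g + 1))} ∪
      Set.range (c : Fin r → PuncturedSurfaceGroup (g + 1) r)) with hKdef
  haveI hKn : K.Normal := Subgroup.normalClosure_normal
  have hcK : ∀ j, c (g := g + 1) (r := r) j ∈ K := fun j =>
    Subgroup.subset_normalClosure (Or.inr ⟨j, rfl⟩)
  have hbK : b (r := r) (0 : Fin (g + 1)) ∈ K := Subgroup.subset_normalClosure (Or.inl rfl)
  have hcommK : a (r := r) (0 : Fin (g + 1)) * b 0 * (a 0)⁻¹ * (b 0)⁻¹ ∈ K :=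
    K.mul_mem (by simpa using hKn.conj_mem _ hbK (a (r := r) (0 : Fin (g + 1)))) (K.inv_mem hbK)
  -- the tail of the relator: `∏_{j} [a_{j+1}, b_{j+1}] ∈ K`
  set Y : PuncturedSurfaceGroup (g + 1) r := ((List.finRange g).map fun j : Fin g =>
      a (r := r) (Fin.succ j) * b (Fin.succ j) * (a (Fin.succ j))⁻¹ * (b (Fin.succ j))⁻¹).prod with hY
  have hrel : a (r := r) (0 : Fin (g + 1)) * b 0 * (a 0)⁻¹ * (b 0)⁻¹ * Y *
      ((List.finRange r).map fun j : Fin r => c (g := g + 1) j).prod = 1 := by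
    have h := comm_prod_mul_cusp_prod_eq_one (g := g + 1) (r := r)
    rw [List.finRange_succ, List.map_cons, List.prod_cons, List.map_map] at h
    exact h
  have hCK : ((List.finRange r).map fun j : Fin r => c (g := g + 1) j).prod ∈ K :=
    Subgroup.list_prod_mem _ fun y hy => by
      obtain ⟨j, -, rfl⟩ := List.mem_map.mp hy
      exact hcK j
  have hYK : Y ∈ K := by
    have hYe : Y = (a (r := r) (0 : Fin (g + 1)) * b 0 * (a 0)⁻¹ * (b 0)⁻¹)⁻¹ *
        (((List.finRange r).map fun j : Fin r => c (g := g + 1) j).prod)⁻¹ := by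
      have h1 : Y * ((List.finRange r).map fun j : Fin r => c (g := g + 1) j).prod =
          (a (r := r) (0 : Fin (g + 1)) * b 0 * (a 0)⁻¹ * (b 0)⁻¹)⁻¹ :=
        eq_inv_of_mul_eq_one_right (by rw [← mul_assoc]; exact hrel)
      rw [← h1, mul_inv_cancel_right]
    rw [hYe]
    exact K.mul_mem (K.inv_mem hcommK) (K.inv_mem hCK)
  -- (1) `Φ : Γ → Γ_{g,0} ∗ ℤ`
  let fA : Fin (g + 1) → Bool → Coprod (PuncturedSurfaceGroup g 0) (Multiplicative ℤ) :=
    Fin.cases (motive := fun _ => Bool → Coprod (PuncturedSurfaceGroup g 0) (Multiplicative ℤ))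
      (fun bit => if bit then 1 else Coprod.inr (ofAdd (1 : ℤ)))
      (fun j bit => Coprod.inl (PresentedGroup.of (Sum.inl (j, bit))))
  have hfA_zero : ∀ bit, fA 0 bit = if bit then 1 else Coprod.inr (ofAdd (1 : ℤ)) := fun bit => by
    simp only [fA, Fin.cases_zero]
  have hfA_succ : ∀ j bit, fA (Fin.succ j) bit = Coprod.inl (PresentedGroup.of (Sum.inl (j, bit))) :=
    fun j bit => by simp only [fA, Fin.cases_succ]
  let f : puncturedSurfaceGen (g + 1) r → Coprod (PuncturedSurfaceGroup g 0) (Multiplicative ℤ) :=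
    Sum.elim (fun q => fA q.1 q.2) fun _ => 1
  have hcommS : ∀ j : Fin g, f (Sum.inl (Fin.succ j, false)) * f (Sum.inl (Fin.succ j, true)) *
      (f (Sum.inl (Fin.succ j, false)))⁻¹ * (f (Sum.inl (Fin.succ j, true)))⁻¹ =
      Coprod.inl (a (r := 0) j * b j * (a j)⁻¹ * (b j)⁻¹) := fun j => by
    simp only [f, Sum.elim_inl, hfA_succ, map_mul, map_inv]; rfl
  have hfrel : ∀ v ∈ ({relator (g + 1) r} : Set (FreeGroup (puncturedSurfaceGen (g + 1) r))),
      FreeGroup.lift f v = 1 := by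
    intro v hv
    rw [Set.mem_singleton_iff] at hv
    rw [hv, lift_relator, List.finRange_succ, List.map_cons, List.prod_cons, List.map_map]
    have h3 : ((List.finRange r).map fun j => f (Sum.inr j)).prod = 1 :=
      List.prod_eq_one fun y hy => by
        obtain ⟨j, -, rfl⟩ := List.mem_map.mp hy
        rfl
    have h0 : f (Sum.inl ((0 : Fin (g + 1)), false)) * f (Sum.inl ((0 : Fin (g + 1)), true)) *
        (f (Sum.inl ((0 : Fin (g + 1)), false)))⁻¹ * (f (Sum.inl ((0 : Fin (g + 1)), true)))⁻¹ = 1 := by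
      simp only [f, Sum.elim_inl, hfA_zero, if_true]
      simp
    have h1 : ((List.finRange g).map ((fun i : Fin (g + 1) =>
        f (Sum.inl (i, false)) * f (Sum.inl (i, true)) * (f (Sum.inl (i, false)))⁻¹ *
          (f (Sum.inl (i, true)))⁻¹) ∘ Fin.succ)).prod = 1 := by
      rw [show ((fun i : Fin (g + 1) => f (Sum.inl (i, false)) * f (Sum.inl (i, true)) *
          (f (Sum.inl (i, false)))⁻¹ * (f (Sum.inl (i, true)))⁻¹) ∘ Fin.succ) =
          (Coprod.inl : PuncturedSurfaceGroup g 0 →* Coprod (PuncturedSurfaceGroup g 0) (Multiplicative ℤ)) ∘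
            fun j => a (r := 0) j * b j * (a j)⁻¹ * (b j)⁻¹
          from funext fun j => hcommS j, ← List.map_map, ← map_list_prod, comm_prod_eq_one_zero, map_one]
    rw [h0, h1, h3, one_mul, one_mul]
  let Φ : PuncturedSurfaceGroup (g + 1) r →* Coprod (PuncturedSurfaceGroup g 0) (Multiplicative ℤ) :=
    PresentedGroup.toGroup hfrel
  have hΦof : ∀ x, Φ (PresentedGroup.of x) = f x := fun x => PresentedGroup.toGroup.of hfrel
  have hΦa0 : Φ (a 0) = Coprod.inr (ofAdd (1 : ℤ)) := by
    rw [a, hΦof]; simp only [f, Sum.elim_inl, hfA_zero]; rfl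
  have hΦb0 : Φ (b 0) = 1 := by
    rw [b, hΦof]; simp only [f, Sum.elim_inl, hfA_zero, if_true]
  have hΦs : ∀ (j : Fin g) (bit : Bool), Φ (PresentedGroup.of (Sum.inl (Fin.succ j, bit))) =
      Coprod.inl (PresentedGroup.of (Sum.inl (j, bit))) := fun j bit => by
    rw [hΦof]; simp only [f, Sum.elim_inl, hfA_succ]
  have hΦc : ∀ j, Φ (c j) = 1 := fun j => hΦof (Sum.inr j)
  have hKΦ : K ≤ Φ.ker := by
    refine Subgroup.normalClosure_le_normal ?_
    rintro x (hx | ⟨j, rfl⟩)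
    · rw [Set.mem_singleton_iff] at hx
      rw [SetLike.mem_coe, MonoidHom.mem_ker, hx, hΦb0]
    · rw [SetLike.mem_coe, MonoidHom.mem_ker]; exact hΦc j
  let Φb : PuncturedSurfaceGroup (g + 1) r ⧸ K →* Coprod (PuncturedSurfaceGroup g 0) (Multiplicative ℤ) :=
    QuotientGroup.lift K Φ hKΦ
  have hΦb : ∀ x : PuncturedSurfaceGroup (g + 1) r, Φb (QuotientGroup.mk x) = Φ x := fun x =>
    QuotientGroup.lift_mk' K hKΦ x
  -- (2) `Ψ : Γ_{g,0} ∗ ℤ → Γ/K`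
  let f₀ : puncturedSurfaceGen g 0 → PuncturedSurfaceGroup (g + 1) r ⧸ K :=
    Sum.elim (fun q => QuotientGroup.mk (PresentedGroup.of (Sum.inl (Fin.succ q.1, q.2)))) Fin.elim0
  have hf₀rel : ∀ v ∈ ({relator g 0} : Set (FreeGroup (puncturedSurfaceGen g 0))),
      FreeGroup.lift f₀ v = 1 := by
    intro v hv
    rw [Set.mem_singleton_iff] at hv
    rw [hv, lift_relator, List.finRange_zero, List.map_nil, List.prod_nil, mul_one]
    have : (fun j : Fin g => f₀ (Sum.inl (j, false)) * f₀ (Sum.inl (j, true)) * (f₀ (Sum.inl (j, false)))⁻¹ *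
        (f₀ (Sum.inl (j, true)))⁻¹) = (QuotientGroup.mk' K) ∘ fun j => a (r := r) (Fin.succ j) *
          b (Fin.succ j) * (a (Fin.succ j))⁻¹ * (b (Fin.succ j))⁻¹ := by
      funext j; simp only [f₀, Sum.elim_inl, Function.comp_apply, map_mul, map_inv]; rfl
    rw [this, ← List.map_map, ← map_list_prod, ← hY, QuotientGroup.mk'_apply, QuotientGroup.eq_one_iff]
    exact hYK
  let ψ₀ : PuncturedSurfaceGroup g 0 →* PuncturedSurfaceGroup (g + 1) r ⧸ K := PresentedGroup.toGroup hf₀rel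
  have hψ₀ : ∀ (j : Fin g) (bit : Bool), ψ₀ (PresentedGroup.of (Sum.inl (j, bit))) =
      QuotientGroup.mk (PresentedGroup.of (Sum.inl (Fin.succ j, bit))) :=
    fun j bit => PresentedGroup.toGroup.of hf₀rel
  let ψ₁ : Multiplicative ℤ →* PuncturedSurfaceGroup (g + 1) r ⧸ K :=
    zpowersHom _ (QuotientGroup.mk (a (r := r) (0 : Fin (g + 1))))
  have hψ₁ : ψ₁ (ofAdd (1 : ℤ)) = QuotientGroup.mk (a (r := r) (0 : Fin (g + 1))) := by
    change (zpowersHom _ _) (ofAdd (1 : ℤ)) = _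
    rw [zpowersHom_apply, toAdd_ofAdd, zpow_one]
  let Ψ : Coprod (PuncturedSurfaceGroup g 0) (Multiplicative ℤ) →* PuncturedSurfaceGroup (g + 1) r ⧸ K :=
    Coprod.lift ψ₀ ψ₁
  -- (3) the two compositions
  have h1 : Ψ.comp Φb = MonoidHom.id _ := by
    refine QuotientGroup.monoidHom_ext _ (PresentedGroup.ext fun x => ?_)
    change Ψ (Φb (QuotientGroup.mk (PresentedGroup.of x))) = QuotientGroup.mk (PresentedGroup.of x)
    rw [hΦb]
    rcases x with ⟨i, bit⟩ | j
    · induction i using Fin.cases with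
      | zero =>
        cases bit
        · change Ψ (Φ (a 0)) = QuotientGroup.mk (a 0)
          rw [hΦa0]
          show Coprod.lift ψ₀ ψ₁ (Coprod.inr _) = _
          rw [Coprod.lift_apply_inr, hψ₁]
        · change Ψ (Φ (b 0)) = QuotientGroup.mk (b 0)
          rw [hΦb0, map_one, eq_comm, QuotientGroup.eq_one_iff]
          exact hbK
      | succ j =>
        rw [hΦs]
        show Coprod.lift ψ₀ ψ₁ (Coprod.inl _) = _
        rw [Coprod.lift_apply_inl, hψ₀]
    · change Ψ (Φ (c j)) = QuotientGroup.mk (c j)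
      rw [hΦc, map_one, eq_comm, QuotientGroup.eq_one_iff]
      exact hcK j
  have h2 : Φb.comp Ψ = MonoidHom.id _ := by
    refine Coprod.hom_ext (PresentedGroup.ext fun y => ?_) (MonoidHom.ext_mint ?_)
    · change Φb (Ψ (Coprod.inl (PresentedGroup.of y))) = Coprod.inl (PresentedGroup.of y)
      rcases y with ⟨j, bit⟩ | j
      · show Φb (Coprod.lift ψ₀ ψ₁ (Coprod.inl (PresentedGroup.of _))) = _
        rw [Coprod.lift_apply_inl, hψ₀, hΦb, hΦs]
      · exact Fin.elim0 j
    · change Φb (Ψ (Coprod.inr (ofAdd (1 : ℤ)))) = Coprod.inr (ofAdd (1 : ℤ))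
      show Φb (Coprod.lift ψ₀ ψ₁ (Coprod.inr _)) = _
      rw [Coprod.lift_apply_inr, hψ₁, hΦb, hΦa0]
  refine ⟨hKn, MonoidHom.toMulEquiv Φb Ψ h1 h2, fun j bit => ?_, ?_⟩
  · rw [MonoidHom.toMulEquiv_apply, hΦb, hΦs]
  · rw [MonoidHom.toMulEquiv_apply, hΦb, hΦa0]

end PuncturedSurfaceGroup

end Literature.GroupTheory.CombinatorialGroupTheory
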